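import Summits.ABC.ABC.Theorems.IsogenyGlueCongruenceEllipticGluingPrimeBoundStubCMIsotypicCoreOfAux1
import Literature.AlgebraicGeometry.Motives.FaltingsECEndomorphismsProofs
import HarnessLib

/-!
# CM isotypic core (stub `stub_CMIsotypicCoreOf`, line `Sketch`) — helpers 2/2: irreducibility and
# scalar commutant of `W[ℓ]` from the CM torsion fact ((S_CM))

Helper file (2/2) for stub `stub_CMIsotypicCoreOf` (the CM isotypic core (K\*)) of line `Sketch`
(isotypic–Minkowski reduction) of crux U
`Summit.ABC.ABC.Theses.IsogenyGlueCongruence.EllipticGluingPrimeBound` (stmt-ABC-13919); helpers 1/2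
are `…StubCMIsotypicCoreOfAux1` (non-abelian image), the stub itself is proved in
`…EllipticGluingPrimeBoundStubCMIsotypicCoreOf`.

"The CM torsion fact" is the HYPOTHESIS `hF2` of the stub (registered neighbour
`stub_cmTorsionCartanImage`): `φ = √D` on `W[ℓ]` (`φ² = D`, `ℓ ∤ D`), the quadratic character `χ`
with `φ(σP) = χ(σ)·σφ(P)`, and the `12`-th powers of the Cartan `(O/ℓ)^×` realised by `ker χ`.

Contents:
* `CMIsotypicCore.irreducible_of_cmCartanImage` — the CM torsion fact implies that `W[ℓ]` is an
  irreducible `Γ_ℚ`-module for `ℓ > max L₀ 13` (a CM substitute for Mazur's theorem, uniform in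
  `W`): a stable `H ≠ 0, W[ℓ]` is a line `𝔽_ℓ P₀`; with `τ` acting as
  `(a + √D)^{12} = P_D(a) + Q_D(a)√D` (`C_add_X_pow_twelve`), `τP₀ ∈ H` and `ℓ ∤ Q_D(a)` give
  `√D P₀ = c P₀`; `σ₀ P₀ = d P₀` for `χ(σ₀) = −1`; computing `√D(σ₀P₀)` in two ways gives
  `2cd P₀ = 0`, so `c = 0` or `d = 0`, both absurd;
* `hasCM_irreducible_scalar_of_cmCartanImage` (registered sub-goal; main namespace) = (S_CM): for
  `W` with CM and `ℓ > L₀'`, `W[ℓ]` is irreducible AND every `Γ_ℚ`-equivariant additive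
  endomorphism of `W[ℓ]` is an integer scalar (a non-scalar equivariant `f` would make every Galois
  element a polynomial `p + q f` in `f` — the tree's two-dimensional commutant lemma
  `exists_eq_smul_one_add_smul_of_commute` — hence any two of them commute, contradicting
  `nonabelianImage_of_cmCartanImage`).

Everything is proved (axioms `propext`, `Classical.choice`, `Quot.sound`); no `def`, no named
fact. Deliberately NOT here: the composition with the rational-part reduction, Minkowski and the
torsion leaf (the stub file).
-/

noncomputable section

-- `Summit.<Summit>.<Problem>` is the mandated summit-side namespace (CONVENTIONS §2); for the
-- single-conjunct summit `ABC` the two coincide, so the duplicate `ABC.ABC` is deliberate.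
set_option linter.dupNamespace false

namespace Summit.ABC.ABC.Theorems.IsotypicMinkowski

open Polynomial
open Literature.AlgebraicGeometry.Motives

namespace CMIsotypicCore

/-- **The CM torsion fact implies irreducibility of `W[ℓ]` over `Γ_ℚ`** (replaces Mazur's theorem
inside (S_CM)). At a prime `ℓ > max L₀ 13`: pick `a` with `a + √D` a unit and `ℓ ∤ Q_D(a)`, and
`τ ∈ ker χ` acting as `(a + √D)^{12} = P_D(a) + Q_D(a)√D` (`C_add_X_pow_twelve` at `√D`). If
`H ⊂ W[ℓ]` is a `Γ_ℚ`-stable subgroup, `H ≠ 0, W[ℓ]`, then `H` is a line `𝔽_ℓ P₀` (a second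
independent vector would make `H` everything, `dim W[ℓ] = 2`); from `τP₀ ∈ H` and `ℓ ∤ Q_D(a)`,
`√D P₀ = c P₀ ∈ H`; from stability under `σ₀` (`χ(σ₀) = −1`), `σ₀P₀ = d P₀`; computing `√D(σ₀P₀)`
in two ways (`√D` anti-commutes with `σ₀`) gives `2cd·P₀ = 0`, so `c = 0` (then `√D P₀ = 0`,
contradicting injectivity of `√D`, `ℓ ∤ D`) or `d = 0` (then `σ₀P₀ = 0`, `P₀ = 0`). No case
distinction inert/split is needed. [folklore] -/
theorem irreducible_of_cmCartanImage
    (hF2 : ∃ L₀ : ℕ, ∀ (W : WeierstrassCurve ℚ) [W.IsElliptic], W.HasCM → ∀ ℓ : ℕ, ℓ.Prime → L₀ < ℓ →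
      ∃ (φ : AddMonoid.End (W.geomTorsion ℓ)) (D : ℤ) (χ : Field.absoluteGaloisGroup ℚ →* ℤˣ),
        (∀ P : W.geomTorsion ℓ, φ (φ P) = D • P) ∧ ¬ (ℓ : ℤ) ∣ D ∧
        (∀ c : ℤ, ∃ P : W.geomTorsion ℓ, φ P ≠ c • P) ∧
        (∃ σ : Field.absoluteGaloisGroup ℚ, χ σ ≠ 1) ∧
        (∀ (σ : Field.absoluteGaloisGroup ℚ) (P : W.geomTorsion ℓ),
          φ (σ • P) = ((χ σ : ℤˣ) : ℤ) • σ • φ P) ∧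
        (∀ a b : ℤ, ¬ (ℓ : ℤ) ∣ a ^ 2 - D * b ^ 2 →
          ∃ σ : Field.absoluteGaloisGroup ℚ, χ σ = 1 ∧ ∀ P : W.geomTorsion ℓ,
            σ • P = (((a : AddMonoid.End (W.geomTorsion ℓ)) +
              (b : AddMonoid.End (W.geomTorsion ℓ)) * φ) ^ 12) P)) :
    ∃ L₀ : ℕ, ∀ (W : WeierstrassCurve ℚ) [W.IsElliptic], W.HasCM → ∀ ℓ : ℕ, ℓ.Prime → L₀ < ℓ →
      W.HasIrreducibleModPGaloisRep ℓ := by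
  classical
  obtain ⟨L₀, h2⟩ := hF2
  refine ⟨max L₀ 13, ?_⟩
  intro W _ hCM ℓ hℓ hL
  have hL₀ : L₀ < ℓ := lt_of_le_of_lt (le_max_left _ _) hL
  have h13 : 13 < ℓ := lt_of_le_of_lt (le_max_right _ _) hL
  haveI : Fact ℓ.Prime := ⟨hℓ⟩
  obtain ⟨φ, D, χ, hφφ, hD, -, ⟨σ₀, hσ₀⟩, hsemi, hbig⟩ := h2 W hCM ℓ hℓ hL₀
  letI : Module (ZMod ℓ) (W.geomTorsion ℓ) := AddSubgroup.torsionBy.zmodModule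
  have hmul : ∀ (f g : AddMonoid.End (W.geomTorsion ℓ)) (P : W.geomTorsion ℓ),
      (f * g) P = f (g P) := fun _ _ _ ↦ rfl
  have hadd : ∀ (f g : AddMonoid.End (W.geomTorsion ℓ)) (P : W.geomTorsion ℓ),
      (f + g) P = f P + g P := fun _ _ _ ↦ rfl
  -- `χ σ₀ = -1`, so `φ` anticommutes with `σ₀`
  have hχ₀ : ((χ σ₀ : ℤˣ) : ℤ) = -1 := by
    rcases Int.units_eq_one_or (χ σ₀) with h | h
    · exact absurd h hσ₀
    · rw [h]; rfl
  have hanti : ∀ P : W.geomTorsion ℓ, φ (σ₀ • P) = -(σ₀ • φ P) := fun P ↦ by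
    rw [hsemi σ₀ P, hχ₀, neg_one_zsmul]
  -- `φ² = D`; `φ` is injective since `ℓ ∤ D`
  have hφ2 : φ ^ 2 = (D : AddMonoid.End (W.geomTorsion ℓ)) := by
    refine DFunLike.ext _ _ fun P ↦ ?_
    rw [sq, hmul, hφφ, AddMonoid.End.intCast_apply]
  have hDmod : ((D : ℤ) : ZMod ℓ) ≠ 0 := fun h ↦
    hD ((ZMod.intCast_zmod_eq_zero_iff_dvd D ℓ).1 h)
  have hφinj : ∀ P : W.geomTorsion ℓ, φ P = 0 → P = 0 := fun P hP ↦ by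
    have h1 : D • P = 0 := by rw [← hφφ, hP, map_zero]
    have h2 : ((D : ℤ) : ZMod ℓ) • P = 0 := by rwa [Int.cast_smul_eq_zsmul]
    exact (smul_eq_zero.1 h2).resolve_left hDmod
  -- choose `a` with `a + √D` a unit and `ℓ ∤ Q(a)`
  obtain ⟨x, hx1, hx2⟩ := exists_sq_ne_and_eval_ne_zero h13 ((D : ℤ) : ZMod ℓ)
  set a : ℤ := ((x.val : ℕ) : ℤ) with ha_def
  have ha : ((a : ℤ) : ZMod ℓ) = x := by
    rw [ha_def, Int.cast_natCast, ZMod.natCast_zmod_val]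
  set Qa : ℤ := 12 * a ^ 11 + 220 * a ^ 9 * D + 792 * a ^ 7 * D ^ 2 + 792 * a ^ 5 * D ^ 3 +
    220 * a ^ 3 * D ^ 4 + 12 * a * D ^ 5 with hQa_def
  set Pa : ℤ := a ^ 12 + 66 * a ^ 10 * D + 495 * a ^ 8 * D ^ 2 + 924 * a ^ 6 * D ^ 3 +
    495 * a ^ 4 * D ^ 4 + 66 * a ^ 2 * D ^ 5 + D ^ 6 with hPa_def
  have haunit : ¬ (ℓ : ℤ) ∣ a ^ 2 - D * 1 ^ 2 := fun h ↦ by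
    apply hx1
    have h' := (ZMod.intCast_zmod_eq_zero_iff_dvd _ ℓ).2 h
    push_cast [ha] at h'
    linear_combination h'
  have hQmod : ((Qa : ℤ) : ZMod ℓ) ≠ 0 := fun h ↦ by
    apply hx2
    rw [hQa_def] at h
    push_cast [ha] at h
    linear_combination h
  -- the Galois element acting as `U ^ 12 = Pa + Qa • φ`
  obtain ⟨τ, -, hτ⟩ := hbig a 1 haunit
  have hU : (a : AddMonoid.End (W.geomTorsion ℓ)) +
      ((1 : ℤ) : AddMonoid.End (W.geomTorsion ℓ)) * φ = (a : AddMonoid.End _) + φ := by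
    rw [Int.cast_one, one_mul]
  have hT : ((a : AddMonoid.End (W.geomTorsion ℓ)) + φ) ^ 12 =
      (Pa : AddMonoid.End (W.geomTorsion ℓ)) + φ * (Qa : AddMonoid.End (W.geomTorsion ℓ)) := by
    have h := congrArg (Polynomial.aeval (R := ℤ) φ) (C_add_X_pow_twelve a)
    simp only [map_pow, map_add, map_mul, Polynomial.aeval_C, Polynomial.aeval_X,
      algebraMap_int_eq, Int.coe_castRingHom, map_ofNat] at h
    rw [hφ2] at h
    rw [h, hPa_def, hQa_def]
    congr 1
    · push_cast; rfl
    · congr 1; push_cast; rfl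
  have hτ' : ∀ P : W.geomTorsion ℓ, τ • P = Pa • P + φ (Qa • P) := fun P ↦ by
    rw [hτ P, hU, hT, hadd, hmul, AddMonoid.End.intCast_apply, AddMonoid.End.intCast_apply]
  -- irreducibility
  intro H hH
  by_contra hcon
  push Not at hcon
  obtain ⟨hbot, htop⟩ := hcon
  obtain ⟨P₀, hP₀H, hP₀⟩ : ∃ P ∈ H, P ≠ 0 := by
    by_contra h
    push Not at h
    exact hbot ((AddSubgroup.eq_bot_iff_forall _).2 h)
  -- finrank 2
  have hcard : Nat.card (W.geomTorsion ℓ) = ℓ ^ 2 := by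
    have h := Literature.NumberTheory.EllipticCurves.natCard_geomTorsion_int_eq_sq W
      (n := (ℓ : ℤ)) (by exact_mod_cast hℓ.ne_zero)
    rwa [Int.natAbs_natCast] at h
  haveI : Finite (W.geomTorsion ℓ) :=
    Nat.finite_of_card_ne_zero (by rw [hcard]; exact pow_ne_zero 2 hℓ.ne_zero)
  haveI : Module.Finite (ZMod ℓ) (W.geomTorsion ℓ) := Module.Finite.of_finite
  have hrank : Module.finrank (ZMod ℓ) (W.geomTorsion ℓ) = 2 := by
    have h := Module.natCard_eq_pow_finrank (K := ZMod ℓ) (V := W.geomTorsion ℓ)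
    rw [hcard, Nat.card_zmod] at h
    exact (Nat.pow_right_injective hℓ.two_le h).symm
  -- every element of `H` is a multiple of `P₀` (else `H` would contain a basis)
  have hline : ∀ Q ∈ H, ∃ c : ZMod ℓ, c • P₀ = Q := by
    intro Q hQ
    by_contra hc
    push Not at hc
    have hli : LinearIndependent (ZMod ℓ) ![P₀, Q] := by
      rw [LinearIndependent.pair_iff]
      intro s t hst
      by_cases ht : t = 0
      · rw [ht, zero_smul, add_zero] at hst
        exact ⟨(smul_eq_zero.1 hst).resolve_right hP₀, ht⟩
      · exfalso
        apply hc (-(t⁻¹ * s))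
        have h1 : t • Q = -(s • P₀) := eq_neg_of_add_eq_zero_right hst
        calc (-(t⁻¹ * s)) • P₀ = t⁻¹ • (-(s • P₀)) := by rw [neg_smul, smul_neg, mul_smul]
          _ = Q := by rw [← h1, smul_smul, inv_mul_cancel₀ ht, one_smul]
    let b : Module.Basis (Fin 2) (ZMod ℓ) (W.geomTorsion ℓ) :=
      basisOfLinearIndependentOfCardEqFinrank hli (by rw [Fintype.card_fin, hrank])
    have hb : ⇑b = ![P₀, Q] := coe_basisOfLinearIndependentOfCardEqFinrank _ _
    have hb0 : b 0 = P₀ := by rw [hb]; rfl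
    have hb1 : b 1 = Q := by rw [hb]; rfl
    apply htop
    rw [AddSubgroup.eq_top_iff']
    intro v
    have hv := b.sum_repr v
    rw [Fin.sum_univ_two, hb0, hb1] at hv
    rw [← hv]
    exact H.add_mem (ZMod.smul_mem hP₀H _) (ZMod.smul_mem hQ _)
  -- `φ P₀ ∈ H`: from `τ • P₀ ∈ H` and `ℓ ∤ Qa`
  have hφP₀ : φ P₀ ∈ H := by
    have h1 : τ • P₀ ∈ H := hH τ P₀ hP₀H
    rw [hτ', ← Int.cast_smul_eq_zsmul (ZMod ℓ) Qa, ZMod.map_smul] at h1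
    have h2 : ((Qa : ℤ) : ZMod ℓ) • φ P₀ ∈ H := by
      have := H.sub_mem h1 (zsmul_mem hP₀H Pa)
      rwa [add_sub_cancel_left] at this
    have h3 := ZMod.smul_mem h2 (((Qa : ℤ) : ZMod ℓ))⁻¹
    rwa [smul_smul, inv_mul_cancel₀ hQmod, one_smul] at h3
  obtain ⟨c, hc⟩ := hline _ hφP₀
  obtain ⟨d, hd⟩ := hline _ (hH σ₀ P₀ hP₀H)
  -- compare `φ (σ₀ • P₀)` computed in two ways
  have hσlin : ∀ (e : ZMod ℓ) (P : W.geomTorsion ℓ), σ₀ • (e • P) = e • σ₀ • P := fun e P ↦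
    ZMod.map_smul (DistribSMul.toAddMonoidHom (W.geomTorsion ℓ) σ₀) e P
  have h1 : φ (σ₀ • P₀) = (d * c) • P₀ := by
    rw [← hd, ZMod.map_smul, ← hc, smul_smul]
  have h2 : φ (σ₀ • P₀) = -((c * d) • P₀) := by
    rw [hanti, ← hc, hσlin, ← hd, smul_smul]
  have h3 : (2 * (c * d)) • P₀ = 0 := by
    have h := h1.symm.trans h2
    rw [mul_comm d c] at h
    rw [mul_smul, two_smul]
    exact add_eq_zero_iff_eq_neg.2 h
  have h2ne : (2 : ZMod ℓ) ≠ 0 := by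
    intro h
    have h' : ((2 : ℕ) : ZMod ℓ) = 0 := by exact_mod_cast h
    rw [ZMod.natCast_eq_zero_iff] at h'
    exact absurd (Nat.le_of_dvd two_pos h') (by omega)
  rcases mul_eq_zero.1 ((smul_eq_zero.1 h3).resolve_right hP₀) with h4 | h4
  · exact h2ne h4
  · rcases mul_eq_zero.1 h4 with h5 | h5
    · -- `c = 0`: `φ P₀ = 0`, so `P₀ = 0`
      apply hP₀
      apply hφinj
      rw [← hc, h5, zero_smul]
    · -- `d = 0`: `σ₀ • P₀ = 0`, so `P₀ = 0`
      apply hP₀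
      have h6 : σ₀ • P₀ = 0 := by rw [← hd, h5, zero_smul]
      have := congrArg (fun R ↦ σ₀⁻¹ • R) h6
      simpa only [inv_smul_smul, smul_zero] using this

end CMIsotypicCore

open CMIsotypicCore in
/-- **(S_CM) from the CM torsion fact** (registered sub-goal of `stub_CMIsotypicCoreOf`): for `W/ℚ`
with CM and every prime `ℓ > L₀'`, `W[ℓ]` is an irreducible `Γ_ℚ`-module whose `Γ_ℚ`-equivariant
additive endomorphisms are integer scalars. Irreducibility is `irreducible_of_cmCartanImage`.
Scalar commutant: `W[ℓ] ≅ 𝔽_ℓ²` (`natCard_geomTorsion_int_eq_sq`); an equivariant `f` is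
`𝔽_ℓ`-linear; if `f` is not a scalar then every Galois element, commuting with `f`, is of the form
`p + q f` (`exists_eq_smul_one_add_smul_of_commute`: the commutant of a cyclic endomorphism of a
plane), so any two Galois elements commute on `W[ℓ]` — contradicting
`nonabelianImage_of_cmCartanImage`. Threshold `L₀' = max L_irr L_nonab`. [folklore] -/
theorem hasCM_irreducible_scalar_of_cmCartanImage
    (hF2 : ∃ L₀ : ℕ, ∀ (W : WeierstrassCurve ℚ) [W.IsElliptic], W.HasCM → ∀ ℓ : ℕ, ℓ.Prime → L₀ < ℓ →
      ∃ (φ : AddMonoid.End (W.geomTorsion ℓ)) (D : ℤ) (χ : Field.absoluteGaloisGroup ℚ →* ℤˣ),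
        (∀ P : W.geomTorsion ℓ, φ (φ P) = D • P) ∧ ¬ (ℓ : ℤ) ∣ D ∧
        (∀ c : ℤ, ∃ P : W.geomTorsion ℓ, φ P ≠ c • P) ∧
        (∃ σ : Field.absoluteGaloisGroup ℚ, χ σ ≠ 1) ∧
        (∀ (σ : Field.absoluteGaloisGroup ℚ) (P : W.geomTorsion ℓ),
          φ (σ • P) = ((χ σ : ℤˣ) : ℤ) • σ • φ P) ∧
        (∀ a b : ℤ, ¬ (ℓ : ℤ) ∣ a ^ 2 - D * b ^ 2 →
          ∃ σ : Field.absoluteGaloisGroup ℚ, χ σ = 1 ∧ ∀ P : W.geomTorsion ℓ,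
            σ • P = (((a : AddMonoid.End (W.geomTorsion ℓ)) +
              (b : AddMonoid.End (W.geomTorsion ℓ)) * φ) ^ 12) P)) :
    ∃ L₀ : ℕ, ∀ (W : WeierstrassCurve ℚ) [W.IsElliptic], W.HasCM → ∀ ℓ : ℕ, ℓ.Prime → L₀ < ℓ →
      W.HasIrreducibleModPGaloisRep ℓ ∧
        ∀ f : W.geomTorsion ℓ →+ W.geomTorsion ℓ,
          (∀ (σ : Field.absoluteGaloisGroup ℚ) (P : W.geomTorsion ℓ), f (σ • P) = σ • f P) →
          ∃ n : ℤ, ∀ P : W.geomTorsion ℓ, f P = n • P := by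
  classical
  obtain ⟨L₂, hirr⟩ := irreducible_of_cmCartanImage hF2
  obtain ⟨L₁, hna⟩ := nonabelianImage_of_cmCartanImage hF2
  refine ⟨max L₂ L₁, ?_⟩
  intro W _ hCM ℓ hℓ hL
  have hL₂ : L₂ < ℓ := lt_of_le_of_lt (le_max_left _ _) hL
  have hL₁ : L₁ < ℓ := lt_of_le_of_lt (le_max_right _ _) hL
  refine ⟨hirr W hCM ℓ hℓ hL₂, fun f hf ↦ ?_⟩
  haveI : Fact ℓ.Prime := ⟨hℓ⟩
  -- the `𝔽_ℓ`-structure on `V = W[ℓ]`, of cardinality `ℓ²`, hence of dimension `2`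
  letI : Module (ZMod ℓ) (W.geomTorsion ℓ) := AddSubgroup.torsionBy.zmodModule
  have hcard : Nat.card (W.geomTorsion ℓ) = ℓ ^ 2 := by
    have h := Literature.NumberTheory.EllipticCurves.natCard_geomTorsion_int_eq_sq W
      (n := (ℓ : ℤ)) (by exact_mod_cast hℓ.ne_zero)
    rwa [Int.natAbs_natCast] at h
  haveI : Finite (W.geomTorsion ℓ) :=
    Nat.finite_of_card_ne_zero (by rw [hcard]; exact pow_ne_zero 2 hℓ.ne_zero)
  haveI : Module.Finite (ZMod ℓ) (W.geomTorsion ℓ) := Module.Finite.of_finite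
  have hrank : Module.finrank (ZMod ℓ) (W.geomTorsion ℓ) = 2 := by
    have h := Module.natCard_eq_pow_finrank (K := ZMod ℓ) (V := W.geomTorsion ℓ)
    rw [hcard, Nat.card_zmod] at h
    exact (Nat.pow_right_injective hℓ.two_le h).symm
  -- `f` and the Galois elements as `𝔽_ℓ`-linear endomorphisms
  let fL : Module.End (ZMod ℓ) (W.geomTorsion ℓ) := f.toZModLinearMap ℓ
  have hfL : ∀ P, fL P = f P := fun P ↦ rfl
  let gL : Field.absoluteGaloisGroup ℚ → Module.End (ZMod ℓ) (W.geomTorsion ℓ) := fun σ ↦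
    (DistribSMul.toAddMonoidHom (W.geomTorsion ℓ) σ).toZModLinearMap ℓ
  have hgL : ∀ σ P, gL σ P = σ • P := fun σ P ↦ rfl
  have hcomm : ∀ σ, gL σ * fL = fL * gL σ := fun σ ↦ by
    ext P
    rw [Module.End.mul_apply, Module.End.mul_apply, hgL, hfL, hfL, hgL, hf]
  by_cases hsc : ∃ c : ZMod ℓ, fL = c • 1
  · -- scalar case: read off the integer
    obtain ⟨c, hc⟩ := hsc
    refine ⟨((c.val : ℕ) : ℤ), fun P ↦ ?_⟩
    have h1 : f P = c • P := by
      rw [← hfL, hc]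
      rfl
    rw [h1, natCast_zsmul, ← Nat.cast_smul_eq_nsmul (ZMod ℓ), ZMod.natCast_zmod_val]
  · -- non-scalar `f`: every Galois element is a polynomial in `f`, so any two commute — absurd
    exfalso
    obtain ⟨σ, τ, P, hP⟩ := hna W hCM ℓ hℓ hL₁
    obtain ⟨p, q, hpq⟩ := exists_eq_smul_one_add_smul_of_commute hrank hsc (hcomm σ)
    obtain ⟨p', q', hpq'⟩ := exists_eq_smul_one_add_smul_of_commute hrank hsc (hcomm τ)
    have h11 : Commute (p • (1 : Module.End (ZMod ℓ) (W.geomTorsion ℓ))) (p' • 1) :=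
      ((Commute.refl 1).smul_left p).smul_right p'
    have h12 : Commute (p • (1 : Module.End (ZMod ℓ) (W.geomTorsion ℓ))) (q' • fL) :=
      ((Commute.one_left fL).smul_left p).smul_right q'
    have h21 : Commute (q • fL) (p' • (1 : Module.End (ZMod ℓ) (W.geomTorsion ℓ))) :=
      ((Commute.one_right fL).smul_left q).smul_right p'
    have h22 : Commute (q • fL) (q' • fL) := ((Commute.refl fL).smul_left q).smul_right q'
    have key : Commute (gL σ) (gL τ) := by
      rw [hpq, hpq']
      exact (h11.add_right h12).add_left (h21.add_right h22)
    apply hP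
    have h := congrArg (fun g : Module.End (ZMod ℓ) (W.geomTorsion ℓ) ↦ g P) key.eq
    simpa only [Module.End.mul_apply, hgL] using h

end Summit.ABC.ABC.Theorems.IsotypicMinkowski

end
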